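import Summits.CriticalPhenomena.CardyFormulaZ2.Theorems.CardyComplexConeDefs
import Literature.Probability.LatticeModels.WeightTable

/-!
# The vertex relation, per pair of configurations: the once/twice bookkeeping
(line `qkz-strip-boundary-arm` of crux `CardyComplexCone.EdgePrecompact`, stmt-CriticalPhenomena-11387;
third file of the stub `stub_vertexRelation`, the `q = 1` half-Cauchy–Riemann vertex relation)

The spin-`1/3` corner observable of the exploration path `γ` (cut orbit `orb` of the start corner,
exit time `N`) at a coded corner `q` is the expectation of the ORBIT PHASE SUM
`∑_{j < N, orb j = q} φ (turnCount j)` with `φ m = exp (−iπm/6)` (each step turns by `±π/2`, spin `1/3`;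
`φ` is kept abstract: any `φ : ℤ → ℂ` with `φ (m + n) = φ m · φ n`). The vertex relation at an interior
medial vertex `e` is proved by pairing `ω` with `ω △ {e}`. Under toggling `e = cTgt d`, a pair of
completed configurations agreeing off `e` visits `e` either never/never (both contributions vanish) or
ONCE/TWICE (`InterfaceRearrangement.lean`, cases 1 and 2): in the once-configuration `ω₁` the dart
`d = orb i₁` arrives at `e` and turns by `σ = turnSign d`, its partner `d₂` (the other corner arriving at
`e`) not being a dart; in the twice-configuration `ω₂` the path arrives along `d`, turns the other way,
runs once around the cycle `L` of `d₂` (minimal period `Q`), arrives again along `d₂` and leaves as `ω₁`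
did. This file computes the four pair sums (`vertexRelation_onceTwice`, registered sub-goal): with
`a = φ (turnCount i₁)` and GIVEN the turning number `∑_{L} turnSign = 4σ` of the loop (the planar input,
`spliceLoop_turning_eq` of `…VertexRelationSpliceLoop.lean`, true for Jordan data and false on holed
domains),

  `d ↦ 2a`, `next_{ω₁} d ↦ 2a·φ(σ)`... precisely `2 φ (C + σ)`, `next_{ω₂} d ↦ φ (C − σ)`, `d₂ ↦ φ (C + 2σ)`,

`C = turnCount i₁`: the second arrival carries `C − σ + (4σ − σ) = C + 2σ` quarter turns. The next file
turns these values into the vertex relation with `χ = +i` (two identities in `ℤ[e^{iπ/6}]`).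

References: S. Smirnov, Ann. of Math. 172 (2010), proof of Lemma 4.5 (the involution and its table, at
`q = 2`); H. Duminil-Copin, S. Smirnov, arXiv:1109.1549, §8, Prop. 8.6 (the `q = 1` vertex relation).
-/

namespace Summit.CriticalPhenomena.CardyFormulaZ2.Cruxes.EdgePrecompact.QkzStripBoundaryArm

open MeasureTheory Filter Set Metric
open scoped Topology BigOperators Pointwise
open Literature.Probability.LatticeModels Literature.Probability.Percolation
open Literature.Probability.RandomPlanarGeometry (DobrushinDomain)
open Summit.CriticalPhenomena.CardyFormulaZ2.Theses.CardyComplexCone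

/-! ## Small tools -/

/-- The turning rule moves every corner (its face index changes by `1` or `3`). -/
theorem nextCorner_ne_self (β : BondConfig (Site 2)) (q : Site 2 × Fin 4) : nextCorner β q ≠ q := by
  intro h
  by_cases hm : cTgt q ∈ β
  · rw [nextCorner_of_mem hm] at h
    have h2 := congrArg Prod.snd h
    exact fin4_add_three_ne q.2 h2
  · rw [nextCorner_of_not_mem hm] at h
    have h2 := congrArg Prod.snd h
    simp at h2

/-- Exit times are unique: the first non-inner time of an orbit. -/
theorem exit_unique {In : ℕ → Prop} {N N' : ℕ} (hN : ¬ In N) (hlt : ∀ k < N, In k) (hN' : ¬ In N')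
    (hlt' : ∀ k < N', In k) : N = N' := by
  by_contra h
  rcases Nat.lt_or_gt_of_ne h with h | h
  · exact hN (hlt' N h)
  · exact hN' (hlt N' h)

/-- A filtered sum whose predicate holds at exactly one point of the range. -/
theorem sum_filter_eq_single {M : Type*} [AddCommMonoid M] (s : Finset ℕ) (P : ℕ → Prop)
    [DecidablePred P] (f : ℕ → M) {j₀ : ℕ} (hj₀ : j₀ ∈ s) (hP : P j₀)
    (huniq : ∀ j ∈ s, P j → j = j₀) : ∑ j ∈ s.filter P, f j = f j₀ := by
  have : s.filter P = {j₀} := by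
    ext j
    simp only [Finset.mem_filter, Finset.mem_singleton]
    exact ⟨fun h => huniq j h.1 h.2, fun h => by subst h; exact ⟨hj₀, hP⟩⟩
  rw [this, Finset.sum_singleton]

/-- A filtered sum whose predicate never holds on the range vanishes. -/
theorem sum_filter_eq_zero_of_forall_not {M : Type*} [AddCommMonoid M] (s : Finset ℕ) (P : ℕ → Prop)
    [DecidablePred P] (f : ℕ → M) (h : ∀ j ∈ s, ¬ P j) : ∑ j ∈ s.filter P, f j = 0 :=
  Finset.sum_eq_zero fun j hj => absurd (Finset.mem_filter.1 hj).2 (h j (Finset.mem_filter.1 hj).1)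

/-- Corners arriving at the same edge turn alike. -/
theorem turnSign_partner (β : BondConfig (Site 2)) (q : Site 2 × Fin 4) :
    turnSign β (cornerPartner q) = turnSign β q := by
  classical
  unfold turnSign; rw [cTgt_partner]

/-- Toggling the target edge flips the turn sign. -/
theorem turnSign_toggle {β β' : BondConfig (Site 2)} {q : Site 2 × Fin 4}
    (hdiff : ¬ (cTgt q ∈ β' ↔ cTgt q ∈ β)) : turnSign β' q = -turnSign β q := by
  by_cases h : cTgt q ∈ β
  · have h' : cTgt q ∉ β' := fun h' => hdiff ⟨fun _ => h, fun _ => h'⟩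
    simp [turnSign_of_mem h, turnSign_of_not_mem h']
  · have h' : cTgt q ∈ β' := by
      by_contra h'
      exact hdiff ⟨fun h'' => absurd h'' h', fun h'' => absurd h'' h⟩
    simp [turnSign_of_not_mem h, turnSign_of_mem h']


/-! ## The once/twice pair -/

/-- **The four pair sums of a once/twice pair** (registered sub-goal `vertexRelation_onceTwice` of
stmt-CriticalPhenomena-11387). Admissible data `E`, start corner `c₀`; two configurations whose
completions agree off the edge `e = cTgt d` and differ at `e`, both endpoints of `e` interior (all faces
inner); in the ONCE-configuration `ω₁` (exit time `N₁`) the corner `d = orb i₁` is a dart and its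
partner is not; `Q` is the minimal period of the partner's cycle under `ω₁`, ASSUMED to turn by
`4 · turnSign d`; `N₂` is the exit time of `ω₂`. Then, for any `φ : ℤ → ℂ`, the sums over the two
paths of `φ (turnCount j)` over the visits `j` of: `d`; the successor of `d` in `ω₁`; the successor
of `d` in `ω₂`; the partner of `d` — are `2 φ C`, `2 φ (C + σ)`, `φ (C − σ)`, `φ (C + 2σ)` with
`C = turnCount i₁` (in `ω₁`) and `σ = turnSign d` (in `ω₁`). -/
theorem vertexRelation_onceTwice : ∀ (φ : ℤ → ℂ) (E : DiscreteDobrushin), E.IsZdAdmissible → ∀ (ω₁ ω₂ : BondConfig (Site 2)) (c₀ d : Site 2 × Fin 4) (N₁ N₂ i₁ Q : ℕ), E.IsStartCorner c₀ → (∀ e', e' ≠ cTgt d → (e' ∈ E.bcBondConfig ω₂ ↔ e' ∈ E.bcBondConfig ω₁)) → ¬ (cTgt d ∈ E.bcBondConfig ω₂ ↔ cTgt d ∈ E.bcBondConfig ω₁) → (∀ j, E.IsInnerFace (faceAt d.1 j)) → (∀ j, E.IsInnerFace (faceAt (d.1 + cornerUnit (d.2 + 1)) j)) → ¬ E.IsInnerFace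 (cFace (cornerOrbit (E.bcBondConfig ω₁) c₀ N₁)) → (∀ k < N₁, E.IsInnerFace (cFace (cornerOrbit (E.bcBondConfig ω₁) c₀ k))) → ¬ E.IsInnerFace (cFace (cornerOrbit (E.bcBondConfig ω₂) c₀ N₂)) → (∀ k < N₂, E.IsInnerFace (cFace (cornerOrbit (E.bcBondConfig ω₂) c₀ k))) → cornerOrbit (E.bcBondConfig ω₁) c₀ i₁ = d → i₁ < N₁ → (∀ i < N₁, cornerOrbit (E.bcBondConfig ω₁) c₀ i ≠ cornerPartner d) → 0 < Q → cornerOrbit (E.bcBondConfig ω₁) (cornerPartner d) Q = cornerPartner d → (∀ s, 0 < s → s < Q → cornerOrbit (E.bcBondConfig ω₁) (cornerPartner d) s ≠ cornerPartner d) → ∑ m ∈ Finset.range Q, turnSign (E.bcBondConfig ω₁) (cornerOrbit (E.bcBondConfig ω₁) (cornerPartner d) m) = 4 * turnSign (E.bcBondConfig ω₁) d → (∑ j ∈ (Finset.range N₁).filter (fun j => cornerOrbit (E.bcBondConfig ω₁) c₀ j = d), φ (turnCount (E.bcBondConfig ω₁) c₀ j)) + (∑ j ∈ (Finset.range N₂).filter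 (fun j => cornerOrbit (E.bcBondConfig ω₂) c₀ j = d), φ (turnCount (E.bcBondConfig ω₂) c₀ j)) = 2 * φ (turnCount (E.bcBondConfig ω₁) c₀ i₁) ∧ (∑ j ∈ (Finset.range N₁).filter (fun j => cornerOrbit (E.bcBondConfig ω₁) c₀ j = nextCorner (E.bcBondConfig ω₁) d), φ (turnCount (E.bcBondConfig ω₁) c₀ j)) + (∑ j ∈ (Finset.range N₂).filter (fun j => cornerOrbit (E.bcBondConfig ω₂) c₀ j = nextCorner (E.bcBondConfig ω₁) d), φ (turnCount (E.bcBondConfig ω₂) c₀ j)) = 2 * φ (turnCount (E.bcBondConfig ω₁) c₀ i₁ + turnSign (E.bcBondConfig ω₁) d) ∧ (∑ j ∈ (Finset.range N₁).filter (fun j => cornerOrbit (E.bcBondConfig ω₁) c₀ j = nextCorner (E.bcBondConfig ω₂) d), φ (turnCount (E.bcBondConfig ω₁) c₀ j)) + (∑ j ∈ (Finset.range N₂).filter (fun j => cornerOrbit (E.bcBondConfig ω₂) c₀ j = nextCorner (E.bcBondConfig ω₂) d), φ (turnCount (E.bcBondConfig ω₂) c₀ j)) = φ (turnCount (E.bcBondConfig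 ω₁) c₀ i₁ - turnSign (E.bcBondConfig ω₁) d) ∧ (∑ j ∈ (Finset.range N₁).filter (fun j => cornerOrbit (E.bcBondConfig ω₁) c₀ j = cornerPartner d), φ (turnCount (E.bcBondConfig ω₁) c₀ j)) + (∑ j ∈ (Finset.range N₂).filter (fun j => cornerOrbit (E.bcBondConfig ω₂) c₀ j = cornerPartner d), φ (turnCount (E.bcBondConfig ω₂) c₀ j)) = φ (turnCount (E.bcBondConfig ω₁) c₀ i₁ + 2 * turnSign (E.bcBondConfig ω₁) d) := by
  intro φ E hE ω₁ ω₂ c₀ d N₁ N₂ i₁ Q hc₀ hagree hdiff hx hy hN₁ hlt₁ hN₂ hlt₂ hi₁ hi₁N h₂ hQ0 hQ hQmin hT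
  classical
  have hstep : ∀ (β : BondConfig (Site 2)) (c : Site 2 × Fin 4) (i : ℕ),
      cornerOrbit β c (i + 1) = nextCorner β (cornerOrbit β c i) := fun _ _ _ => rfl
  -- the far endpoint `y` of `e` is interior, so `d` is not the last dart
  have hyB : (cornerPartner d).1 ∉ E.zdArcB := by
    intro h
    rcases E.zdArcB_subset_zdBoundary h with ⟨-, w, hvw, hnot⟩ | ⟨w, -, -, g, hg, hvg, -⟩
    · obtain ⟨k, rfl⟩ := exists_eq_add_cornerUnit hvw
      exact hnot (DiscreteDobrushin.adj_of_isInnerFace_faceAt (hy k) (Or.inl rfl))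
    · obtain ⟨k, rfl⟩ := exists_faceAt_of_isCorner hvg
      exact hg (hy k)
  have hi₁1 : i₁ + 1 < N₁ := by
    by_contra hcon
    have hN1 : N₁ = i₁ + 1 := by omega
    subst hN1
    obtain ⟨-, -, hB, -⟩ := cornerOrbit_exit hE hc₀ (n := i₁) (hlt₁ i₁ hi₁N) hN₁
    rw [hi₁] at hB
    exact hyB hB
  -- darts of the once-path are distinct
  have hinj : ∀ a b, a < N₁ → b < N₁ → cornerOrbit (E.bcBondConfig ω₁) c₀ a = cornerOrbit (E.bcBondConfig ω₁) c₀ b → a = b := by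
    intro a b ha hb h
    by_contra hne
    rcases Nat.lt_or_gt_of_ne hne with hab | hab
    · exact cornerOrbit_ne hE hc₀ hab (fun k hk => hlt₁ k (by omega)) h
    · exact cornerOrbit_ne hE hc₀ hab (fun k hk => hlt₁ k (by omega)) h.symm
  -- the interface orbit of `ω₁` is periodic; the partner's loop misses it entirely
  have hp₂in : E.IsInnerFace (cFace (cornerPartner d)) := hy _
  have hc₀mesh : c₀.1 ∈ meshDomain E.Ω E.δ := fst_mem_meshDomain_of_isInnerFace (q := c₀) hc₀.isOutEdge.1
  have hexP : ∃ P, 0 < P ∧ cornerOrbit (E.bcBondConfig ω₁) c₀ P = c₀ := exists_cornerOrbit_period hE hc₀mesh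
  have hP₀0 : 0 < Nat.find hexP := (Nat.find_spec hexP).1
  have hP₀ : cornerOrbit (E.bcBondConfig ω₁) c₀ (Nat.find hexP) = c₀ := (Nat.find_spec hexP).2
  have hP₀min : ∀ s, 0 < s → s < Nat.find hexP → cornerOrbit (E.bcBondConfig ω₁) c₀ s ≠ c₀ :=
    fun s hs hsP h => Nat.find_min hexP hsP ⟨hs, h⟩
  have hdisj : ∀ m s, cornerOrbit (E.bcBondConfig ω₁) (cornerPartner d) m ≠ cornerOrbit (E.bcBondConfig ω₁) c₀ s := by
    intro m s h
    obtain ⟨s', hs'⟩ := exists_eq_cornerOrbit_of_iterate hP₀0 hP₀ m h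
    have hin : E.IsInnerFace (cFace (cornerOrbit (E.bcBondConfig ω₁) c₀ s')) := hs' ▸ hp₂in
    rw [isInnerFace_cornerOrbit_iff hE hc₀ hN₁ hlt₁ hP₀0 hP₀ hP₀min] at hin
    exact h₂ _ hin (by rw [cornerOrbit_mod_period hP₀]; exact hs'.symm)
  have hLinj : ∀ a b, a < Q → b < Q →
      cornerOrbit (E.bcBondConfig ω₁) (cornerPartner d) a = cornerOrbit (E.bcBondConfig ω₁) (cornerPartner d) b → a = b := by
    intro a b ha hb h
    by_contra hne
    rcases Nat.lt_or_gt_of_ne hne with hab | hab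
    · obtain ⟨t, rfl⟩ := Nat.exists_eq_add_of_lt hab
      have := cornerOrbit_eq_of_add_eq (cornerPartner d) (i := 0) (j := t + 1) a
        (by rwa [zero_add, show t + 1 + a = a + t + 1 by omega])
      exact hQmin (t + 1) (Nat.succ_pos _) (by omega) this.symm
    · obtain ⟨t, rfl⟩ := Nat.exists_eq_add_of_lt hab
      have := cornerOrbit_eq_of_add_eq (cornerPartner d) (i := 0) (j := t + 1) b
        (by rw [zero_add, show t + 1 + b = b + t + 1 by omega]; exact h.symm)
      exact hQmin (t + 1) (Nat.succ_pos _) (by omega) this.symm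
  have hQ1 : 1 < Q := by
    by_contra h1
    have hQ1 : Q = 1 := by omega
    rw [hQ1] at hQ
    exact nextCorner_ne_self _ _ hQ
  -- the twice-path: prefix, loop, tail (case 1 of the rearrangement), exit at `N₁ + Q`
  obtain ⟨hpre, hloop, htail, hlt₂', hN₂'⟩ := cornerOrbit_toggle_case1 hE hc₀ hagree hdiff hx hy hN₁ hlt₁ hP₀0 hP₀ hP₀min
    hQ0 hQ hQmin hi₁ hi₁N h₂
  obtain rfl : N₂ = N₁ + Q := exit_unique hN₂ hlt₂ hN₂' hlt₂'
  have horb₂ : ∀ j < N₁ + Q, (j ≤ i₁ ∧ cornerOrbit (E.bcBondConfig ω₂) c₀ j = cornerOrbit (E.bcBondConfig ω₁) c₀ j) ∨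
      (∃ m, 0 < m ∧ m ≤ Q ∧ j = i₁ + m ∧ cornerOrbit (E.bcBondConfig ω₂) c₀ j = cornerOrbit (E.bcBondConfig ω₁) (cornerPartner d) m) ∨
      (∃ t, i₁ + 1 + t < N₁ ∧ j = i₁ + Q + 1 + t ∧ cornerOrbit (E.bcBondConfig ω₂) c₀ j = cornerOrbit (E.bcBondConfig ω₁) c₀ (i₁ + 1 + t)) := by
    intro j hj
    by_cases h1 : j ≤ i₁
    · exact Or.inl ⟨h1, hpre j h1⟩
    · by_cases h2 : j ≤ i₁ + Q
      · refine Or.inr (Or.inl ⟨j - i₁, by omega, by omega, by omega, ?_⟩)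
        have := hloop (j - i₁ - 1) (by omega)
        rwa [show i₁ + 1 + (j - i₁ - 1) = j by omega, show j - i₁ - 1 + 1 = j - i₁ by omega] at this
      · refine Or.inr (Or.inr ⟨j - i₁ - Q - 1, by omega, by omega, ?_⟩)
        have := htail (j - i₁ - Q - 1) (by omega)
        rwa [show i₁ + Q + 1 + (j - i₁ - Q - 1) = j by omega] at this
  -- target edges other than those of `d`, `d₂` are not `e`
  have htgt₁ : ∀ j < N₁, j ≠ i₁ → cTgt (cornerOrbit (E.bcBondConfig ω₁) c₀ j) ≠ cTgt d := by
    intro j hj hji h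
    rcases cTgt_eq_cTgt_iff.1 h with h | h
    · exact hji (hinj j i₁ hj hi₁N (h.trans hi₁.symm))
    · exact h₂ j hj h
  have htgtL : ∀ m, 0 < m → m < Q → cTgt (cornerOrbit (E.bcBondConfig ω₁) (cornerPartner d) m) ≠ cTgt d := by
    intro m hm hmQ h
    rcases cTgt_eq_cTgt_iff.1 h with h | h
    · exact hdisj m i₁ (h.trans hi₁.symm)
    · exact hQmin m hm hmQ h
  -- turn signs and turn counts
  have hσ₂ : turnSign (E.bcBondConfig ω₂) d = -turnSign (E.bcBondConfig ω₁) d := turnSign_toggle hdiff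
  have hσ₂' : turnSign (E.bcBondConfig ω₂) (cornerPartner d) = -turnSign (E.bcBondConfig ω₁) d := by
    rw [← turnSign_partner (E.bcBondConfig ω₁) d]
    exact turnSign_toggle (by rwa [cTgt_partner])
  have hC₁ : turnCount (E.bcBondConfig ω₂) c₀ i₁ = turnCount (E.bcBondConfig ω₁) c₀ i₁ :=
    turnCount_congr_prefix (fun j hj => hpre j hj) (fun j hj => hagree _ (htgt₁ j (by omega) (by omega)))
  have hC₁b : turnCount (E.bcBondConfig ω₁) c₀ (i₁ + 1) = turnCount (E.bcBondConfig ω₁) c₀ i₁ + turnSign (E.bcBondConfig ω₁) d := by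
    rw [turnCount_succ, hi₁]
  have hC₂a : turnCount (E.bcBondConfig ω₂) c₀ (i₁ + 1) = turnCount (E.bcBondConfig ω₁) c₀ i₁ - turnSign (E.bcBondConfig ω₁) d := by
    rw [turnCount_succ, hC₁, hpre i₁ le_rfl, hi₁, hσ₂]; ring
  have hC₂b : turnCount (E.bcBondConfig ω₂) c₀ (i₁ + Q) = turnCount (E.bcBondConfig ω₁) c₀ i₁ + 2 * turnSign (E.bcBondConfig ω₁) d := by
    have hadd := turnCount_add (E.bcBondConfig ω₂) c₀ (i₁ + 1) (Q - 1)
    rw [show i₁ + 1 + (Q - 1) = i₁ + Q by omega] at hadd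
    have hsum : ∑ m ∈ Finset.range (Q - 1), turnSign (E.bcBondConfig ω₂) (cornerOrbit (E.bcBondConfig ω₂) c₀ (i₁ + 1 + m)) =
        ∑ m ∈ Finset.range (Q - 1), turnSign (E.bcBondConfig ω₁) (cornerOrbit (E.bcBondConfig ω₁) (cornerPartner d) (m + 1)) := by
      refine Finset.sum_congr rfl fun m hm => ?_
      rw [Finset.mem_range] at hm
      rw [hloop m (by omega)]
      exact turnSign_congr (hagree _ (htgtL (m + 1) (Nat.succ_pos _) (by omega)))
    have hT' : ∑ m ∈ Finset.range Q, turnSign (E.bcBondConfig ω₁) (cornerOrbit (E.bcBondConfig ω₁) (cornerPartner d) m) =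
        ∑ m ∈ Finset.range (Q - 1), turnSign (E.bcBondConfig ω₁) (cornerOrbit (E.bcBondConfig ω₁) (cornerPartner d) (m + 1)) +
          turnSign (E.bcBondConfig ω₁) d := by
      conv_lhs => rw [show Q = Q - 1 + 1 by omega, Finset.sum_range_succ']
      rw [← turnSign_partner (E.bcBondConfig ω₁) d]
      rfl
    rw [hadd, hsum, hC₂a]
    rw [hT'] at hT
    linear_combination hT
  have horbQ : cornerOrbit (E.bcBondConfig ω₂) c₀ (i₁ + Q) = cornerPartner d := by
    have := hloop (Q - 1) (by omega)
    rwa [show i₁ + 1 + (Q - 1) = i₁ + Q by omega, show Q - 1 + 1 = Q by omega, hQ] at this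
  have hC₂c : turnCount (E.bcBondConfig ω₂) c₀ (i₁ + Q + 1) = turnCount (E.bcBondConfig ω₁) c₀ i₁ + turnSign (E.bcBondConfig ω₁) d := by
    rw [turnCount_succ, hC₂b, horbQ, hσ₂']; ring
  -- the successors of `d`
  have hn₂ : nextCorner (E.bcBondConfig ω₂) d = cornerOrbit (E.bcBondConfig ω₁) (cornerPartner d) 1 := by
    rw [nextCorner_toggle hagree hdiff, Equiv.swap_apply_left]; rfl
  have hn₁ : nextCorner (E.bcBondConfig ω₁) d = cornerOrbit (E.bcBondConfig ω₁) c₀ (i₁ + 1) := by rw [hstep, hi₁]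
  -- positions on the twice-path
  have horb₂i₁ : cornerOrbit (E.bcBondConfig ω₂) c₀ i₁ = d := (hpre i₁ le_rfl).trans hi₁
  have horb₂n₂ : cornerOrbit (E.bcBondConfig ω₂) c₀ (i₁ + 1) = nextCorner (E.bcBondConfig ω₂) d := by
    rw [hn₂]; exact hloop 0 (by omega)
  have horb₂n₁ : cornerOrbit (E.bcBondConfig ω₂) c₀ (i₁ + Q + 1) = nextCorner (E.bcBondConfig ω₁) d := by
    rw [hn₁]; exact htail 0 (by omega)
  -- uniqueness of the positions on the twice-path
  have huniq_d : ∀ j < N₁ + Q, cornerOrbit (E.bcBondConfig ω₂) c₀ j = d → j = i₁ := by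
    intro j hj h
    rcases horb₂ j hj with ⟨hji, hj'⟩ | ⟨m, hm0, hmQ, rfl, hj'⟩ | ⟨t, ht, rfl, hj'⟩
    · exact hinj j i₁ (by omega) hi₁N ((hj'.symm.trans h).trans hi₁.symm)
    · exact absurd ((hj'.symm.trans h).trans hi₁.symm) (hdisj m i₁)
    · have := hinj _ _ ht hi₁N ((hj'.symm.trans h).trans hi₁.symm); omega
  have huniq_n₂ : ∀ j < N₁ + Q, cornerOrbit (E.bcBondConfig ω₂) c₀ j = nextCorner (E.bcBondConfig ω₂) d → j = i₁ + 1 := by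
    intro j hj h
    rw [hn₂] at h
    rcases horb₂ j hj with ⟨hji, hj'⟩ | ⟨m, hm0, hmQ, rfl, hj'⟩ | ⟨t, ht, rfl, hj'⟩
    · exact absurd (hj'.symm.trans h).symm (hdisj 1 j)
    · rcases Nat.lt_or_ge m Q with hmQ' | hmQ'
      · have := hLinj m 1 hmQ' hQ1 (hj'.symm.trans h); omega
      · have hmQ'' : m = Q := le_antisymm hmQ hmQ'
        subst hmQ''
        rw [hQ] at hj'
        have := hLinj 0 1 hQ0 hQ1 (hj'.symm.trans h)
        omega
    · exact absurd (hj'.symm.trans h).symm (hdisj 1 _)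
  have huniq_d₂ : ∀ j < N₁ + Q, cornerOrbit (E.bcBondConfig ω₂) c₀ j = cornerPartner d → j = i₁ + Q := by
    intro j hj h
    rcases horb₂ j hj with ⟨hji, hj'⟩ | ⟨m, hm0, hmQ, rfl, hj'⟩ | ⟨t, ht, rfl, hj'⟩
    · exact absurd (hj'.symm.trans h) (h₂ j (by omega))
    · rcases Nat.lt_or_ge m Q with hmQ' | hmQ'
      · exact absurd (hj'.symm.trans h) (hQmin m hm0 hmQ')
      · omega
    · exact absurd (hj'.symm.trans h) (h₂ _ ht)
  have huniq_n₁ : ∀ j < N₁ + Q, cornerOrbit (E.bcBondConfig ω₂) c₀ j = nextCorner (E.bcBondConfig ω₁) d → j = i₁ + Q + 1 := by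
    intro j hj h
    rw [hn₁] at h
    rcases horb₂ j hj with ⟨hji, hj'⟩ | ⟨m, hm0, hmQ, rfl, hj'⟩ | ⟨t, ht, rfl, hj'⟩
    · have := hinj j (i₁ + 1) (by omega) hi₁1 (hj'.symm.trans h); omega
    · exact absurd (hj'.symm.trans h) (hdisj m (i₁ + 1))
    · have := hinj _ _ ht hi₁1 (hj'.symm.trans h); omega
  -- evaluate the eight sums
  have e1 := sum_filter_eq_single (Finset.range N₁) (fun j => cornerOrbit (E.bcBondConfig ω₁) c₀ j = d)
    (fun j => φ (turnCount (E.bcBondConfig ω₁) c₀ j)) (Finset.mem_range.2 hi₁N) hi₁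
    (fun j hj h => hinj j i₁ (Finset.mem_range.1 hj) hi₁N (h.trans hi₁.symm))
  have e2 := sum_filter_eq_single (Finset.range (N₁ + Q)) (fun j => cornerOrbit (E.bcBondConfig ω₂) c₀ j = d)
    (fun j => φ (turnCount (E.bcBondConfig ω₂) c₀ j)) (Finset.mem_range.2 (by omega)) horb₂i₁
    (fun j hj h => huniq_d j (Finset.mem_range.1 hj) h)
  have e3 := sum_filter_eq_single (Finset.range N₁) (fun j => cornerOrbit (E.bcBondConfig ω₁) c₀ j = nextCorner (E.bcBondConfig ω₁) d)
    (fun j => φ (turnCount (E.bcBondConfig ω₁) c₀ j)) (Finset.mem_range.2 hi₁1) hn₁.symm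
    (fun j hj h => hinj j (i₁ + 1) (Finset.mem_range.1 hj) hi₁1 (h.trans hn₁))
  have e4 := sum_filter_eq_single (Finset.range (N₁ + Q)) (fun j => cornerOrbit (E.bcBondConfig ω₂) c₀ j = nextCorner (E.bcBondConfig ω₁) d)
    (fun j => φ (turnCount (E.bcBondConfig ω₂) c₀ j)) (Finset.mem_range.2 (by omega)) horb₂n₁
    (fun j hj h => huniq_n₁ j (Finset.mem_range.1 hj) h)
  have e5 := sum_filter_eq_zero_of_forall_not (Finset.range N₁) (fun j => cornerOrbit (E.bcBondConfig ω₁) c₀ j = nextCorner (E.bcBondConfig ω₂) d)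
    (fun j => φ (turnCount (E.bcBondConfig ω₁) c₀ j)) (fun j _ h => hdisj 1 j (by rw [← hn₂, h]))
  have e6 := sum_filter_eq_single (Finset.range (N₁ + Q)) (fun j => cornerOrbit (E.bcBondConfig ω₂) c₀ j = nextCorner (E.bcBondConfig ω₂) d)
    (fun j => φ (turnCount (E.bcBondConfig ω₂) c₀ j)) (Finset.mem_range.2 (by omega)) horb₂n₂
    (fun j hj h => huniq_n₂ j (Finset.mem_range.1 hj) h)
  have e7 := sum_filter_eq_zero_of_forall_not (Finset.range N₁) (fun j => cornerOrbit (E.bcBondConfig ω₁) c₀ j = cornerPartner d)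
    (fun j => φ (turnCount (E.bcBondConfig ω₁) c₀ j)) (fun j hj h => h₂ j (Finset.mem_range.1 hj) h)
  have e8 := sum_filter_eq_single (Finset.range (N₁ + Q)) (fun j => cornerOrbit (E.bcBondConfig ω₂) c₀ j = cornerPartner d)
    (fun j => φ (turnCount (E.bcBondConfig ω₂) c₀ j)) (Finset.mem_range.2 (by omega)) horbQ
    (fun j hj h => huniq_d₂ j (Finset.mem_range.1 hj) h)
  rw [e1, e2, e3, e4, e5, e6, e7, e8, hC₁, hC₁b, hC₂c, hC₂a, hC₂b]
  refine ⟨by ring, by ring, by ring, by ring⟩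

end Summit.CriticalPhenomena.CardyFormulaZ2.Cruxes.EdgePrecompact.QkzStripBoundaryArm
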